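import Mathlib.Analysis.SpecialFunctions.ImproperIntegrals
import Mathlib.Analysis.SpecialFunctions.Trigonometric.Bounds
import Mathlib.MeasureTheory.Integral.ExpDecay
import Mathlib.MeasureTheory.Integral.DominatedConvergence
import Literature.Analysis.SpecialFunctions.TanhPartialFractions
import Literature.MathematicalPhysics.QuantumLattice.DuhamelTwoPoint
import Literature.MathematicalPhysics.QuantumLattice.FermionLiebRobinson
import Literature.MathematicalPhysics.QuantumLattice.FermionOperatorsParityProofs
import Literature.MathematicalPhysics.QuantumLattice.LiebFluxPhaseKronecker
import Literature.MathematicalPhysics.QuantumLattice.LatticeToriProofs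
import Literature.MathematicalPhysics.QuantumLattice.ApproximatingHamiltonianProofs
import Literature.MathematicalPhysics.QuantumLattice.HubbardThermalFermionDecay
import HarnessLib

/-!
# Thermal decay of one-fermion correlations on the Hubbard torus: proof of Hastings' bound

Sibling proof file of `HubbardThermalFermionDecay.lean` (topic `MathematicalPhysics/QuantumLattice`).
It DISCHARGES the named fact
`Literature.MathematicalPhysics.QuantumLattice.hastings2004_oneBody_thermal_decay_hubbardTorus`
(`…_holds`, last declaration): for every `U, μ` there are `C, c₀ > 0` with
`|⟨c†_{xσ} c_{yσ}⟩_{β,L,U,μ}| ≤ C exp(-c₀ dist(x,y)/β)` for the grand-canonical Gibbs state of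
`hubbardTorusWith 2 L 1 U μ`, all `β ≥ 1`, all sides `L`, all sites and spins. No definition and no
named fact is introduced (theorems only); no statement of the fact file is changed.

The proof is the printed one — M. B. Hastings, *Decay of correlations in Fermi systems at nonzero
temperature*, Phys. Rev. Lett. **93** (2004) 126402 = arXiv:cond-mat/0406348, pp. 2–3 (read at the
page, `paper:arxiv-cond-mat_0406348`) — organised in the same order:

* **Block K (eqs. (7)–(8), the Matsubara sum).** Hastings expands the Fermi factor over the odd
  Matsubara frequencies, `(1 + e^{βω})⁻¹ = ½ + (i/β) Σ_{n odd>0} ∫₀^∞ e^{-nπt/β}(e^{iωt} - e^{-iωt}) dt`,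
  and sums `Σ_{n odd>0} e^{-nπt/β} = e^{-πt/β}/(1 - e^{-2πt/β}) =: k(t)`. Here: the odd geometric sum
  (`hasSum_exp_neg_odd_mul`), `∫₀^∞ e^{-ct} sin(ωt) dt = ω/(c² + ω²)` (`integral_exp_neg_mul_sin`),
  term-wise integration by dominated convergence (`tendsto_sum_matsubara_integral`, dominating
  function `(|ω|e^{a}/(2a) + 1/(1 - e^{-2a})) e^{-at}` from Hastings' two kernel bounds
  `k ≤ β/(2πt)`, `k(t) ≤ e^{-πt/β}/(1 - e^{-2πT/β})` for `t ≥ T`), and the partial-fraction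
  expansion of the Fermi function ALREADY IN THE TREE
  (`Literature.Analysis.SpecialFunctions.hasSum_one_div_one_add_exp`, from Mathlib's cotangent
  expansion) give `∫₀^∞ k(t) sin(ωt) dt = (β/2)(½ - 1/(1 + e^{βω}))`
  (`integral_matsubaraKernel_mul_sin`). Also Hastings' split of the time integral
  (`norm_integral_Ioi_le_of_split`, eq. (10)).
* **Block S (eqs. (5)–(6), (9), the integral representation).** In an eigenbasis of `H`
  (`hH.eigenvectorUnitary`; `e^{cH} = U diag(e^{cEᵢ}) U⋆`, `(U⋆ τ_t(A) U)ᵢⱼ = e^{it(Eᵢ-Eⱼ)} A'ᵢⱼ`),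
  `⟨A_ω B⟩ = (1 + e^{βω})⁻¹⟨{A_ω, B}⟩` is the two-line identity `boltzmann_fermi_identity`, and
  summing over pairs of eigenvalues yields Hastings' eq. (9) for MATRICES
  (`hastings_integral_representation`):
  `tr(e^{-βH}AB) = ½ tr(e^{-βH}{A,B}) + (i/β) ∫₀^∞ k(t) (g(t) - g(-t)) dt`,
  `g(t) = tr(e^{-βH}{τ_t(A), B})`, together with the integrability of the integrand.
* **Block P (the anticommutator Lieb–Robinson bound).** Hastings: "for fermionic operators, a
  similar bound can be proven … following the same steps as in [Hastings, PRB 69 (2004) 104431]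
  with commutators replaced by anti-commutators throughout." The tree proves the abstract
  Lieb–Robinson bound `lieb_robinson_abstract` (Hastings–Koma, App. A) and its Hubbard instance for
  COMMUTATORS (`FermionLiebRobinson.lean`). The replacement of commutators by anticommutators is
  realised exactly by the parity twist `[τ_s(A), B P] = {τ_s(A), B} P`, `P = (-1)^N`
  (`commutator_mul_parityOp_eq`): `P` is unitary, anticommutes with every `c, c†`
  (`parityOp_mul_letterOp`), commutes with the even terms of `H(t,U) - μN`
  (`commute_parityOp_of_mem_carEvenSubalgebra`, `commute_parityOp_hamiltonianWith`), so
  `lieb_robinson_abstract` applied to `B P` gives `fermion_lieb_robinson_anticommutator`.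
* **Block G (the torus).** Degree `≤ 4`, the level function `dist(·, y)` (vanishing at `y`,
  `1`-Lipschitz along edges), the `≤ 9` terms of `H` meeting `x` have level `≥ dist(x,y) - 1`;
  whence the closed form `‖{τ_s(A), B}‖ ≤ ‖{A,B}‖ + 36Je · s e^{κs - dist(x,y)}`, `J = 2 + |U| + 2|μ|`,
  `κ = 36eJ` (`norm_anticommutator_hubbardTorus_le`).
* **Assembly (eqs. (10)–(13)).** `{c†_x, c_y} = 0` for `x ≠ y`; split at `T = c₁l`, `c₁ = 1/(2κ)`
  (`v = c₁⁻¹`): on `[0, T]` the kernel bound `k ≤ β/(2πt)` against the Lieb–Robinson bound, beyond `T`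
  the trivial `‖{A(±t), B}‖ ≤ 2` against `k(t) ≤ e^{-πt/β}/(1 - e^{-2})`; for `πc₁l/β < 1` the trivial
  bound `|⟨AB⟩| ≤ 1`. Result (`norm_gibbsState_creation_annihilation_le`): explicit
  `C(U,μ) = e + (36Je/π)(1/2κ)(4/e) + 4/(π(1 - e^{-2}))`, `c₀(U,μ) = min(1/4, π/(2κ))` — Hastings'
  `ξ ≤ max(ξ_C, vβ/π)` with `ξ_C⁻¹` degraded to `1/4` to absorb the polynomial prefactor `l e^{-l/2}`.

## References

* M. B. Hastings, Phys. Rev. Lett. 93 (2004) 126402, arXiv:cond-mat/0406348, eqs. (1), (5)–(13).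
  [HastingsPRL2004FermiDecay]
* M. B. Hastings, T. Koma, Commun. Math. Phys. 265 (2006) 781, App. A (the Lieb–Robinson series,
  through `FermionLiebRobinson.lean`). [HastingsKoma2006]
* G. E. Andrews, R. Askey, R. Roy, *Special Functions* (1999), §1.2 (1.2.5) (partial fractions,
  through `TanhPartialFractions.lean`). [AndrewsAskeyRoy1999]

## Design notes

* Everything about matrices is over `ℂ` with the `L2Operator` (C⋆) norm scope, as in the files it
  builds on; the Gibbs state is `Matrix.gibbsState` of `FinDimSpectrum.lean`, `τ_t` is
  `heisenbergEvolution` of `LocalDynamics.lean`.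
* The torus-level statements carry an arbitrary instance `[DecidableEq (FermionTorus 2 L)]`, which
  the proofs replace by `LinearOrder.toDecidableEq` (`Subsingleton.elim`): the generic lemmas over a
  `LinearOrder`ed site type elaborate their matrix units, norms and exponentials through that
  instance, whereas `Lex (Fin 2 → Fin L)` also carries the computable one; the same device is used
  in `HubbardHubbardModelKomaTasakiProofs.norm_gibbsState_hubbardTorusWith_le`.
* Not here: the general lattice-fermion theorem for arbitrary finite-range even `H` and arbitrary odd
  `A`, `B` (all ingredients above are stated for the Hubbard terms `hubbardTermOp`), uniformity of the
  constants in `μ` (the surplus of the route item over the printed theorem, see the fact file), and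
  the canonical ensemble (open, Hastings p. 4).
-/

noncomputable section

open MeasureTheory Set Filter
open scoped Topology

namespace Literature.MathematicalPhysics.QuantumLattice

/-! ### Block K: the Matsubara kernel `k(x) = e^{-x}/(1 - e^{-2x})` and its sine transform -/

/-- `∫₀^∞ e^{-cω} sin(bω) dω = b/(c² + b²)` for `c > 0` (imaginary part of
`∫₀^∞ e^{(-c+ib)ω} dω = 1/(c - ib)`). [folklore] -/
theorem integral_exp_neg_mul_sin {c : ℝ} (hc : 0 < c) (b : ℝ) :
    ∫ ω in Ioi (0 : ℝ), Real.exp (-(c * ω)) * Real.sin (b * ω) = b / (c ^ 2 + b ^ 2) := by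
  set a : ℂ := -(c : ℂ) + b * Complex.I with ha
  have hare : a.re < 0 := by simp [ha, hc]
  have hint := integral_exp_mul_complex_Ioi hare 0
  have hI := integrableOn_exp_mul_complex_Ioi hare 0
  have him := integral_im hI
  simp only [RCLike.im_to_complex] at him
  rw [hint] at him
  have hfun : (fun ω : ℝ => (Complex.exp (a * ω)).im) =
      fun ω => Real.exp (-(c * ω)) * Real.sin (b * ω) := by
    funext ω
    rw [Complex.exp_im]
    simp [ha, Complex.mul_re, Complex.mul_im]
  rw [hfun] at him
  rw [him]
  simp only [Complex.ofReal_zero, mul_zero, Complex.exp_zero]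
  have hn : Complex.normSq a = c ^ 2 + b ^ 2 := by rw [Complex.normSq_apply]; simp [ha]; ring
  rw [neg_div, Complex.neg_im, Complex.div_im, Complex.one_re, Complex.one_im, hn]
  have hare' : a.re = -c := by simp [ha]
  have haim : a.im = b := by simp [ha]
  rw [hare', haim]
  ring

/-- The denominator of the Matsubara kernel is positive: `0 < 1 - e^{-2x}` for `x > 0`. [folklore] -/
theorem one_sub_exp_neg_two_mul_pos {x : ℝ} (hx : 0 < x) : 0 < 1 - Real.exp (-(2 * x)) := by
  have : Real.exp (-(2 * x)) < 1 := by rw [Real.exp_lt_one_iff]; linarith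
  linarith

/-- The Matsubara kernel is positive. [folklore] -/
theorem matsubaraKernel_pos {x : ℝ} (hx : 0 < x) :
    0 < Real.exp (-x) / (1 - Real.exp (-(2 * x))) :=
  div_pos (Real.exp_pos _) (one_sub_exp_neg_two_mul_pos hx)

/-- **The odd Matsubara sum** `Σ_{n ≥ 0} e^{-(2n+1)x} = e^{-x}/(1 - e^{-2x})` (`x > 0`), Hastings'
"`Σ_{n odd, n>0} exp(-nπt/β) = exp(-πt/β)/(1 - exp(-2πt/β))`". [cite: HastingsPRL2004FermiDecay, after eq. (7)] -/
theorem hasSum_exp_neg_odd_mul {x : ℝ} (hx : 0 < x) :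
    HasSum (fun n : ℕ => Real.exp (-((2 * n + 1) * x)))
      (Real.exp (-x) / (1 - Real.exp (-(2 * x)))) := by
  have hq0 : 0 ≤ Real.exp (-(2 * x)) := (Real.exp_pos _).le
  have hq1 : Real.exp (-(2 * x)) < 1 := by rw [Real.exp_lt_one_iff]; linarith
  have h := (hasSum_geometric_of_lt_one hq0 hq1).mul_left (Real.exp (-x))
  rw [← div_eq_mul_inv] at h
  refine h.congr_fun fun n => ?_
  rw [← Real.exp_nat_mul, ← Real.exp_add]
  congr 1
  ring

/-- Partial odd Matsubara sums are bounded by the kernel. [folklore] -/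
theorem sum_range_exp_neg_odd_mul_le {x : ℝ} (hx : 0 < x) (N : ℕ) :
    ∑ n ∈ Finset.range N, Real.exp (-((2 * n + 1) * x)) ≤
      Real.exp (-x) / (1 - Real.exp (-(2 * x))) :=
  sum_le_hasSum (Finset.range N) (fun _ _ => (Real.exp_pos _).le) (hasSum_exp_neg_odd_mul hx)

/-- Hastings' small-time bound on the kernel: `e^{-x}/(1 - e^{-2x}) ≤ 1/(2x)` for `x > 0`
("`exp(-πt/β)/(1 - exp(-2πt/β)) ≤ β/(2πt)`"; it is `1/(2 sinh x) ≤ 1/(2x)`). [cite: HastingsPRL2004FermiDecay, before eq. (13)] -/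
theorem matsubaraKernel_le_inv {x : ℝ} (hx : 0 < x) :
    Real.exp (-x) / (1 - Real.exp (-(2 * x))) ≤ 1 / (2 * x) := by
  have hden := one_sub_exp_neg_two_mul_pos hx
  rw [div_le_div_iff₀ hden (by positivity), one_mul]
  have hs : x ≤ Real.sinh x := Real.self_le_sinh_iff.2 hx.le
  rw [Real.sinh_eq] at hs
  have h1 : Real.exp (-x) * Real.exp x = 1 := by rw [← Real.exp_add]; simp
  have h2 : Real.exp (-x) * Real.exp (-x) = Real.exp (-(2 * x)) := by
    rw [← Real.exp_add]; congr 1; ring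
  have hE := Real.exp_pos (-x)
  calc Real.exp (-x) * (2 * x) ≤ Real.exp (-x) * (Real.exp x - Real.exp (-x)) :=
        mul_le_mul_of_nonneg_left (by linarith) hE.le
    _ = 1 - Real.exp (-(2 * x)) := by rw [mul_sub, h1, h2]

/-- Hastings' large-time bound on the kernel: `e^{-x}/(1 - e^{-2x}) ≤ e^{-x}/(1 - e^{-2x₀})` for
`x ≥ x₀ > 0`. [cite: HastingsPRL2004FermiDecay, after eq. (12)] -/
theorem matsubaraKernel_le_exp_div {x₀ x : ℝ} (hx₀ : 0 < x₀) (hx : x₀ ≤ x) :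
    Real.exp (-x) / (1 - Real.exp (-(2 * x))) ≤ Real.exp (-x) / (1 - Real.exp (-(2 * x₀))) := by
  refine div_le_div_of_nonneg_left (Real.exp_pos _).le (one_sub_exp_neg_two_mul_pos hx₀) ?_
  have : Real.exp (-(2 * x)) ≤ Real.exp (-(2 * x₀)) := Real.exp_le_exp.2 (by linarith)
  linarith

/-- A single exponential dominating `k(at) |sin(ωt)|` on `t > 0`:
`e^{-at}/(1 - e^{-2at}) · |sin(ωt)| ≤ (|ω|/(2a) e^{a} + 1/(1 - e^{-2a})) e^{-at}`. [folklore] -/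
theorem matsubaraKernel_mul_abs_sin_le {a : ℝ} (ha : 0 < a) (ω : ℝ) {t : ℝ} (ht : 0 < t) :
    Real.exp (-(a * t)) / (1 - Real.exp (-(2 * (a * t)))) * |Real.sin (ω * t)| ≤
      (|ω| / (2 * a) * Real.exp a + 1 / (1 - Real.exp (-(2 * a)))) * Real.exp (-(a * t)) := by
  have hat : 0 < a * t := mul_pos ha ht
  have hk0 := (matsubaraKernel_pos hat).le
  have hE := Real.exp_pos (-(a * t))
  have hden2 := one_sub_exp_neg_two_mul_pos ha
  have hA : 0 ≤ |ω| / (2 * a) * Real.exp a := by positivity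
  have hB : 0 ≤ 1 / (1 - Real.exp (-(2 * a))) := by positivity
  rcases le_or_gt t 1 with ht1 | ht1
  · -- small times: `k ≤ 1/(2at)`, `|sin ωt| ≤ |ω| t`
    have h1 : Real.exp (-(a * t)) / (1 - Real.exp (-(2 * (a * t)))) * |Real.sin (ω * t)| ≤
        |ω| / (2 * a) := by
      calc _ ≤ 1 / (2 * (a * t)) * (|ω| * t) := by
            refine mul_le_mul (matsubaraKernel_le_inv hat) ?_ (abs_nonneg _) (by positivity)
            calc |Real.sin (ω * t)| ≤ |ω * t| := Real.abs_sin_le_abs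
              _ = |ω| * t := by rw [abs_mul, abs_of_pos ht]
        _ = |ω| / (2 * a) := by field_simp
    have h2 : |ω| / (2 * a) ≤ |ω| / (2 * a) * Real.exp a * Real.exp (-(a * t)) := by
      rw [mul_assoc, ← Real.exp_add]
      refine le_mul_of_one_le_right (by positivity) ?_
      rw [Real.one_le_exp_iff]
      nlinarith
    calc _ ≤ |ω| / (2 * a) * Real.exp a * Real.exp (-(a * t)) := h1.trans h2
      _ ≤ _ := by rw [add_mul]; exact le_add_of_nonneg_right (mul_nonneg hB hE.le)
  · -- large times: `k(at) ≤ e^{-at}/(1 - e^{-2a})`, `|sin| ≤ 1`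
    have h1 : Real.exp (-(a * t)) / (1 - Real.exp (-(2 * (a * t)))) * |Real.sin (ω * t)| ≤
        Real.exp (-(a * t)) / (1 - Real.exp (-(2 * a))) := by
      calc _ ≤ Real.exp (-(a * t)) / (1 - Real.exp (-(2 * (a * t)))) * 1 :=
            mul_le_mul_of_nonneg_left (Real.abs_sin_le_one _) hk0
        _ = _ := mul_one _
        _ ≤ _ := matsubaraKernel_le_exp_div ha (by nlinarith)
    calc _ ≤ Real.exp (-(a * t)) / (1 - Real.exp (-(2 * a))) := h1
      _ = 1 / (1 - Real.exp (-(2 * a))) * Real.exp (-(a * t)) := by ring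
      _ ≤ _ := by rw [add_mul]; exact le_add_of_nonneg_left (mul_nonneg hA hE.le)

/-- Each Matsubara term `t ↦ e^{-ct} sin(ωt)` (`c > 0`) is integrable on `(0, ∞)`. [folklore] -/
theorem integrableOn_exp_neg_mul_sin {c : ℝ} (hc : 0 < c) (ω : ℝ) :
    IntegrableOn (fun t : ℝ => Real.exp (-(c * t)) * Real.sin (ω * t)) (Ioi 0) := by
  refine Integrable.mono' (exp_neg_integrableOn_Ioi 0 hc)
    (by fun_prop : Continuous fun t : ℝ => Real.exp (-(c * t)) * Real.sin (ω * t)).aestronglyMeasurable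
    (Eventually.of_forall fun t => ?_)
  rw [Real.norm_eq_abs, abs_mul, Real.abs_exp, neg_mul]
  exact mul_le_of_le_one_right (Real.exp_pos _).le (Real.abs_sin_le_one _)

/-- The sine transform integrand `t ↦ e^{-at}/(1 - e^{-2at}) sin(ωt)` is integrable on `(0, ∞)`
(dominated by a single exponential, `matsubaraKernel_mul_abs_sin_le`). [folklore] -/
theorem integrableOn_matsubaraKernel_mul_sin {a : ℝ} (ha : 0 < a) (ω : ℝ) :
    IntegrableOn (fun t : ℝ =>
      Real.exp (-(a * t)) / (1 - Real.exp (-(2 * (a * t)))) * Real.sin (ω * t)) (Ioi 0) := by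
  set C : ℝ := |ω| / (2 * a) * Real.exp a + 1 / (1 - Real.exp (-(2 * a))) with hC
  have hbound : IntegrableOn (fun t : ℝ => C * Real.exp (-(a * t))) (Ioi 0) :=
    ((exp_neg_integrableOn_Ioi 0 ha).const_mul C).congr
      (Eventually.of_forall fun x => by simp [neg_mul])
  refine Integrable.mono' hbound ?_ ?_
  · exact (Measurable.aestronglyMeasurable (by fun_prop))
  · filter_upwards [ae_restrict_mem measurableSet_Ioi] with t ht
    have ht : (0 : ℝ) < t := ht
    have hat : 0 < a * t := mul_pos ha ht
    rw [Real.norm_eq_abs, abs_mul, abs_of_nonneg (matsubaraKernel_pos hat).le]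
    exact matsubaraKernel_mul_abs_sin_le ha ω ht

/-- **Term-wise integration of the Matsubara series** (dominated convergence): for `a > 0`,
`Σ_{n<N} ω/(((2n+1)a)² + ω²) → ∫₀^∞ e^{-at}/(1 - e^{-2at}) sin(ωt) dt`. [cite: HastingsPRL2004FermiDecay, eqs. (7)–(8)] -/
theorem tendsto_sum_matsubara_integral {a : ℝ} (ha : 0 < a) (ω : ℝ) :
    Tendsto (fun N : ℕ => ∑ n ∈ Finset.range N, ω / (((2 * n + 1) * a) ^ 2 + ω ^ 2)) atTop
      (𝓝 (∫ t in Ioi (0 : ℝ),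
        Real.exp (-(a * t)) / (1 - Real.exp (-(2 * (a * t)))) * Real.sin (ω * t))) := by
  -- the partial sums of the integrands
  set F : ℕ → ℝ → ℝ := fun N t =>
    (∑ n ∈ Finset.range N, Real.exp (-((2 * n + 1) * (a * t)))) * Real.sin (ω * t) with hF
  -- their integrals
  have hint : ∀ N, ∫ t in Ioi (0 : ℝ), F N t =
      ∑ n ∈ Finset.range N, ω / (((2 * n + 1) * a) ^ 2 + ω ^ 2) := by
    intro N
    have e : (fun t => F N t) = fun t => ∑ n ∈ Finset.range N,
        Real.exp (-(((2 * n + 1) * a) * t)) * Real.sin (ω * t) := by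
      funext t
      simp only [hF, Finset.sum_mul]
      refine Finset.sum_congr rfl fun n _ => ?_
      ring_nf
    rw [e, integral_finsetSum]
    · refine Finset.sum_congr rfl fun n _ => ?_
      exact integral_exp_neg_mul_sin (by positivity) ω
    · intro n _
      exact integrableOn_exp_neg_mul_sin (by positivity) ω
  -- dominated convergence
  set C : ℝ := |ω| / (2 * a) * Real.exp a + 1 / (1 - Real.exp (-(2 * a))) with hC
  have hlim := tendsto_integral_of_dominated_convergence (fun t => C * Real.exp (-(a * t)))
    (μ := volume.restrict (Ioi (0 : ℝ))) (F := F)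
    (f := fun t => Real.exp (-(a * t)) / (1 - Real.exp (-(2 * (a * t)))) * Real.sin (ω * t))
    ?_ ?_ ?_ ?_
  rotate_left
  · intro N
    exact (by simp only [hF]; fun_prop : Continuous (F N)).aestronglyMeasurable
  · exact ((exp_neg_integrableOn_Ioi 0 ha).const_mul C).congr
      (Eventually.of_forall fun x => by simp [neg_mul])
  · intro N
    filter_upwards [ae_restrict_mem measurableSet_Ioi] with t ht
    have ht : (0 : ℝ) < t := ht
    have hat : 0 < a * t := mul_pos ha ht
    simp only [hF]
    rw [Real.norm_eq_abs, abs_mul,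
      abs_of_nonneg (Finset.sum_nonneg fun n _ => (Real.exp_pos _).le)]
    calc (∑ n ∈ Finset.range N, Real.exp (-((2 * n + 1) * (a * t)))) * |Real.sin (ω * t)|
        ≤ Real.exp (-(a * t)) / (1 - Real.exp (-(2 * (a * t)))) * |Real.sin (ω * t)| :=
          mul_le_mul_of_nonneg_right (sum_range_exp_neg_odd_mul_le hat N) (abs_nonneg _)
      _ ≤ C * Real.exp (-(a * t)) := matsubaraKernel_mul_abs_sin_le ha ω ht
  · filter_upwards [ae_restrict_mem measurableSet_Ioi] with t ht
    have ht : (0 : ℝ) < t := ht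
    have hat : 0 < a * t := mul_pos ha ht
    simp only [hF]
    exact ((hasSum_exp_neg_odd_mul hat).tendsto_sum_nat).mul_const _
  simp_rw [hint] at hlim
  exact hlim

/-- **The sine transform of the Matsubara kernel** (Hastings' eq. (7) integrated against
`sin ωt`, i.e. the partial-fraction expansion of the Fermi function): for `β > 0` and real `ω`,
`∫₀^∞ e^{-πt/β}/(1 - e^{-2πt/β}) sin(ωt) dt = (β/2)(1/2 - 1/(1 + e^{βω}))`, equivalently
`1/(1 + e^{βω}) = 1/2 - (2/β) ∫₀^∞ k(t) sin(ωt) dt`. [cite: HastingsPRL2004FermiDecay, eq. (7)] -/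
theorem integral_matsubaraKernel_mul_sin {β : ℝ} (hβ : 0 < β) (ω : ℝ) :
    ∫ t in Ioi (0 : ℝ), Real.exp (-(Real.pi / β * t)) / (1 - Real.exp (-(2 * (Real.pi / β * t)))) *
        Real.sin (ω * t) = β / 2 * (1 / 2 - 1 / (1 + Real.exp (β * ω))) := by
  have ha : 0 < Real.pi / β := div_pos Real.pi_pos hβ
  have hlim := tendsto_sum_matsubara_integral ha ω
  -- the same partial sums converge to the partial-fraction value of the Fermi function
  have hsum : HasSum (fun n : ℕ => ω / (((2 * n + 1) * (Real.pi / β)) ^ 2 + ω ^ 2))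
      (β / 2 * (1 / 2 - 1 / (1 + Real.exp (β * ω)))) := by
    have h := (Literature.Analysis.SpecialFunctions.hasSum_one_div_one_add_exp (β * ω)).mul_left (β / 2)
    refine h.congr_fun fun n => ?_
    have hβ0 : β ≠ 0 := hβ.ne'
    have hden : (0 : ℝ) < (β * ω) ^ 2 + (2 * n + 1) ^ 2 * Real.pi ^ 2 := by positivity
    field_simp
    ring
  exact tendsto_nhds_unique hlim hsum.tendsto_sum_nat

/-- **Hastings' split of the time integral** (eq. (10)): if `F` is integrable on `(0, ∞)` with
`‖F(t)‖ ≤ M₁` on `(0, T]` and `‖F(t)‖ ≤ M₂ e^{-at}` on `(T, ∞)` (`a, T > 0`), then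
`‖∫₀^∞ F‖ ≤ M₁ T + M₂ e^{-aT}/a`. [cite: HastingsPRL2004FermiDecay, eqs. (10)–(12)] -/
theorem norm_integral_Ioi_le_of_split {F : ℝ → ℂ} {a T M₁ M₂ : ℝ} (ha : 0 < a) (hT : 0 < T)
    (hF : IntegrableOn F (Ioi 0))
    (h1 : ∀ t ∈ Ioc 0 T, ‖F t‖ ≤ M₁) (h2 : ∀ t ∈ Ioi T, ‖F t‖ ≤ M₂ * Real.exp (-(a * t))) :
    ‖∫ t in Ioi (0 : ℝ), F t‖ ≤ M₁ * T + M₂ * (Real.exp (-(a * T)) / a) := by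
  have hsplit : ∫ t in Ioi (0 : ℝ), F t = (∫ t in Ioc 0 T, F t) + ∫ t in Ioi T, F t := by
    rw [← Ioc_union_Ioi_eq_Ioi hT.le, setIntegral_union Ioc_disjoint_Ioi_same
      measurableSet_Ioi (hF.mono_set Ioc_subset_Ioi_self) (hF.mono_set (Ioi_subset_Ioi hT.le))]
  have hI1 : ‖∫ t in Ioc 0 T, F t‖ ≤ M₁ * T := by
    have := norm_setIntegral_le_of_norm_le_const (measure_Ioc_lt_top (μ := volume)) h1
    rwa [Real.volume_real_Ioc_of_le hT.le, sub_zero] at this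
  have hI2 : ‖∫ t in Ioi T, F t‖ ≤ M₂ * (Real.exp (-(a * T)) / a) := by
    have hgi : IntegrableOn (fun t : ℝ => M₂ * Real.exp (-(a * t))) (Ioi T) := by
      have h0 := (exp_neg_integrableOn_Ioi T ha).const_mul M₂
      simp only [neg_mul] at h0
      exact h0
    calc ‖∫ t in Ioi T, F t‖ ≤ ∫ t in Ioi T, M₂ * Real.exp (-(a * t)) :=
          norm_integral_le_of_norm_le hgi ((ae_restrict_mem measurableSet_Ioi).mono h2)
      _ = M₂ * (Real.exp (-(a * T)) / a) := by
          rw [integral_const_mul]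
          congr 1
          have := integral_exp_mul_Ioi (neg_lt_zero.2 ha) T
          simp only [neg_mul] at this
          rw [this, neg_div_neg_eq]
  rw [hsplit]
  exact (norm_add_le _ _).trans (add_le_add hI1 hI2)

/-! ### Block S: spectral sums and Hastings' integral representation, eq. (9) -/

section Spectral

open Matrix Complex
open scoped Matrix.Norms.L2Operator ComplexOrder

variable {n : Type*} [Fintype n] [DecidableEq n] {H : Matrix n n ℂ}

/-- `e^{cH} = U diag(e^{cEᵢ}) U⋆` for Hermitian `H` and complex `c` (Mathlib `Matrix.exp_conj`,
`Matrix.exp_diagonal`). [folklore] -/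
theorem exp_smul_eq_conj_diagonal (hH : H.IsHermitian) (c : ℂ) :
    NormedSpace.exp (c • H) = (hH.eigenvectorUnitary : Matrix n n ℂ) *
      diagonal (fun i => Complex.exp (c * hH.eigenvalues i)) *
        star (hH.eigenvectorUnitary : Matrix n n ℂ) := by
  set U := (hH.eigenvectorUnitary : Matrix n n ℂ) with hU
  have hUm : U ∈ unitary (Matrix n n ℂ) := hH.eigenvectorUnitary.prop
  have h2 : c • diagonal (fun i => (hH.eigenvalues i : ℂ)) =
      diagonal (fun i => c * (hH.eigenvalues i : ℂ)) := by
    rw [← diagonal_smul]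
    rfl
  have h1 : c • H = U * diagonal (fun i => c * (hH.eigenvalues i : ℂ)) * star U := by
    calc c • H = c • (U * diagonal (fun i => (hH.eigenvalues i : ℂ)) * star U) := by
          conv_lhs => rw [hH.eq_conj_diagonal, ← hU]
      _ = U * (c • diagonal (fun i => (hH.eigenvalues i : ℂ))) * star U := by
          rw [← smul_mul_assoc, ← mul_smul_comm]
      _ = _ := by rw [h2]
  have hunit : IsUnit U := (Unitary.toUnits ⟨U, hUm⟩).isUnit
  have hinv : U⁻¹ = star U := Matrix.inv_eq_left_inv (Unitary.star_mul_self_of_mem hUm)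
  rw [h1, ← hinv, Matrix.exp_conj U _ hunit, Matrix.exp_diagonal]
  congr 2
  funext k
  rw [Pi.exp_def, Complex.exp_eq_exp_ℂ]

/-- `U⋆ e^{cH} U = diag(e^{cEᵢ})`. [folklore] -/
theorem star_mul_exp_smul_mul (hH : H.IsHermitian) (c : ℂ) :
    star (hH.eigenvectorUnitary : Matrix n n ℂ) * NormedSpace.exp (c • H) *
        (hH.eigenvectorUnitary : Matrix n n ℂ) =
      diagonal (fun i => Complex.exp (c * hH.eigenvalues i)) := by
  have hUm : (hH.eigenvectorUnitary : Matrix n n ℂ) ∈ unitary (Matrix n n ℂ) :=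
    hH.eigenvectorUnitary.prop
  rw [exp_smul_eq_conj_diagonal hH c]
  simp only [Matrix.mul_assoc, Unitary.star_mul_self_of_mem hUm, Matrix.mul_one]
  rw [← Matrix.mul_assoc, Unitary.star_mul_self_of_mem hUm, Matrix.one_mul]

/-- **The Heisenberg evolution in an eigenbasis**: `(U⋆ τ_t(A) U)ᵢⱼ = e^{it(Eᵢ - Eⱼ)} (U⋆ A U)ᵢⱼ`
(Hastings: "`A_ω(t) = exp(iωt) A_ω`", `ω = Eᵢ - Eⱼ`). [cite: HastingsPRL2004FermiDecay, before eq. (8)] -/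
theorem star_mul_heisenbergEvolution_mul_apply (hH : H.IsHermitian) (A : Matrix n n ℂ) (t : ℝ)
    (i j : n) :
    (star (hH.eigenvectorUnitary : Matrix n n ℂ) * heisenbergEvolution H t A *
        (hH.eigenvectorUnitary : Matrix n n ℂ)) i j =
      Complex.exp (I * t * ((hH.eigenvalues i : ℂ) - hH.eigenvalues j)) *
        (star (hH.eigenvectorUnitary : Matrix n n ℂ) * A * (hH.eigenvectorUnitary : Matrix n n ℂ)) i j := by
  set U := (hH.eigenvectorUnitary : Matrix n n ℂ) with hU
  have hUm : U ∈ unitary (Matrix n n ℂ) := hH.eigenvectorUnitary.prop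
  have hUU : U * star U = 1 := Unitary.mul_star_self_of_mem hUm
  have key : star U * heisenbergEvolution H t A * U =
      (star U * NormedSpace.exp ((I * t) • H) * U) * (star U * A * U) *
        (star U * NormedSpace.exp ((-(I * t)) • H) * U) := by
    simp only [heisenbergEvolution, Matrix.mul_assoc]
    rw [← Matrix.mul_assoc U (star U) (A * _), hUU, Matrix.one_mul,
      ← Matrix.mul_assoc U (star U) (NormedSpace.exp _ * U), hUU, Matrix.one_mul]
  rw [key, star_mul_exp_smul_mul hH, star_mul_exp_smul_mul hH, mul_diagonal, diagonal_mul,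
    mul_right_comm, ← Complex.exp_add]
  congr 2
  ring

/-- `e^{ix} - e^{-ix} = 2i sin x` for real `x`. [folklore] -/
theorem exp_I_mul_sub_exp_I_mul_neg (x : ℝ) :
    Complex.exp (I * x) - Complex.exp (I * (-(x : ℂ))) = 2 * I * (Real.sin x : ℂ) := by
  rw [show I * (x : ℂ) = x * I by ring, show I * (-(x : ℂ)) = (-(x : ℂ)) * I by ring,
    Complex.exp_mul_I, Complex.exp_mul_I, Complex.cos_neg, Complex.sin_neg, ← Complex.ofReal_sin]
  ring

/-- The Boltzmann weights and the Fermi function: `(pᵢ + pⱼ)/(1 + e^{β(Eᵢ - Eⱼ)}) = pᵢ` for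
`pₖ = e^{-βEₖ}` (Hastings: "`⟨B A_ω⟩_β = ⟨A_ω B⟩_β exp(βω)`", whence eq. (6)). [cite: HastingsPRL2004FermiDecay, eq. (6)] -/
theorem boltzmann_fermi_identity (β x y : ℝ) :
    (Real.exp (-(β * x)) + Real.exp (-(β * y))) * (1 / (1 + Real.exp (β * (x - y)))) =
      Real.exp (-(β * x)) := by
  have hpos : 0 < 1 + Real.exp (β * (x - y)) := by positivity
  rw [mul_one_div, div_eq_iff hpos.ne', mul_add, mul_one, ← Real.exp_add]
  congr 2
  ring

/-- **Hastings' integral representation of thermal correlations through anticommutators**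
(Phys. Rev. Lett. 93 (2004) 126402, eq. (9)), for a Hermitian matrix `H`, `β > 0` and arbitrary
matrices `A`, `B`: with `g(t) = tr(e^{-βH} {τ_t(A), B})`, `τ_t(A) = e^{itH} A e^{-itH}` and the
Matsubara kernel `k(t) = e^{-πt/β}/(1 - e^{-2πt/β})`,
`t ↦ k(t) (g(t) - g(-t))` is integrable on `(0, ∞)` and
`tr(e^{-βH} A B) = ½ tr(e^{-βH} {A, B}) + (i/β) ∫₀^∞ k(t) (g(t) - g(-t)) dt`.
Proof as printed: in an eigenbasis `⟨A_ω B⟩ = (1 + e^{βω})⁻¹ ⟨{A_ω, B}⟩` (eq. (6)), the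
Matsubara expansion `(1 + e^{βω})⁻¹ = ½ + (i/β) Σ_{n odd>0} ∫₀^∞ e^{-nπt/β}(e^{iωt} - e^{-iωt}) dt`
(eq. (7), here `integral_matsubaraKernel_mul_sin`) and `A_ω(t) = e^{iωt} A_ω` (eq. (8)).
[cite: HastingsPRL2004FermiDecay, eqs. (6)–(9)] -/
theorem hastings_integral_representation (hH : H.IsHermitian) {β : ℝ} (hβ : 0 < β)
    (A B : Matrix n n ℂ) :
    IntegrableOn (fun t : ℝ =>
        ((Real.exp (-(Real.pi / β * t)) / (1 - Real.exp (-(2 * (Real.pi / β * t)))) : ℝ) : ℂ) *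
          ((gibbsWeight β H * (heisenbergEvolution H t A * B + B * heisenbergEvolution H t A)).trace -
            (gibbsWeight β H *
              (heisenbergEvolution H (-t) A * B + B * heisenbergEvolution H (-t) A)).trace))
      (Ioi 0) ∧
    (gibbsWeight β H * (A * B)).trace =
      (1 / 2 : ℂ) * (gibbsWeight β H * (A * B + B * A)).trace +
        I / β * ∫ t in Ioi (0 : ℝ),
          ((Real.exp (-(Real.pi / β * t)) / (1 - Real.exp (-(2 * (Real.pi / β * t)))) : ℝ) : ℂ) *
            ((gibbsWeight β H * (heisenbergEvolution H t A * B + B * heisenbergEvolution H t A)).trace -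
              (gibbsWeight β H *
                (heisenbergEvolution H (-t) A * B + B * heisenbergEvolution H (-t) A)).trace) := by
  have ha : 0 < Real.pi / β := div_pos Real.pi_pos hβ
  set U := (hH.eigenvectorUnitary : Matrix n n ℂ) with hU
  have hUm : U ∈ unitary (Matrix n n ℂ) := hH.eigenvectorUnitary.prop
  set E : n → ℝ := hH.eigenvalues with hE
  set A' : Matrix n n ℂ := star U * A * U with hA'
  set B' : Matrix n n ℂ := star U * B * U with hB'
  set p : n → ℝ := fun i => Real.exp (-(β * E i)) with hp
  set K : ℝ → ℝ := fun t =>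
    Real.exp (-(Real.pi / β * t)) / (1 - Real.exp (-(2 * (Real.pi / β * t)))) with hK
  set g : ℝ → ℂ := fun t =>
    (gibbsWeight β H * (heisenbergEvolution H t A * B + B * heisenbergEvolution H t A)).trace with hg
  -- the value of the sine transform of the kernel (Block K)
  set V : n → n → ℝ := fun i j => β / 2 * (1 / 2 - 1 / (1 + Real.exp (β * (E i - E j)))) with hV
  have hKV : ∀ i j, ∫ t in Ioi (0 : ℝ), K t * Real.sin ((E i - E j) * t) = V i j := fun i j =>
    integral_matsubaraKernel_mul_sin hβ (E i - E j)
  -- (1) spectral form of `g`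
  have hg_eq : ∀ t : ℝ, g t = ∑ i, ∑ j, ((p i + p j : ℝ) : ℂ) *
      Complex.exp (I * t * ((E i : ℂ) - E j)) * (A' i j * B' j i) := by
    intro t
    have h1 : (gibbsWeight β H * (heisenbergEvolution H t A * B)).trace =
        ∑ i, ∑ j, (p i : ℂ) * (Complex.exp (I * t * ((E i : ℂ) - E j)) * A' i j) * B' j i := by
      rw [hH.gibbsWeight_eq β, ← hU, trace_unitary_conj_mul, star_unitary_mul_mul_mul hUm,
        ← Matrix.mul_assoc, trace_diagonal_mul_mul]
      refine Finset.sum_congr rfl fun i _ => Finset.sum_congr rfl fun j _ => ?_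
      rw [star_mul_heisenbergEvolution_mul_apply hH A t i j]
    have h2 : (gibbsWeight β H * (B * heisenbergEvolution H t A)).trace =
        ∑ i, ∑ j, (p j : ℂ) * (Complex.exp (I * t * ((E i : ℂ) - E j)) * A' i j) * B' j i := by
      rw [hH.gibbsWeight_eq β, ← hU, trace_unitary_conj_mul, star_unitary_mul_mul_mul hUm,
        ← Matrix.mul_assoc, trace_diagonal_mul_mul, Finset.sum_comm]
      refine Finset.sum_congr rfl fun i _ => Finset.sum_congr rfl fun j _ => ?_
      rw [star_mul_heisenbergEvolution_mul_apply hH A t i j]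
      ring
    simp only [hg]
    rw [Matrix.mul_add, trace_add, h1, h2, ← Finset.sum_add_distrib]
    refine Finset.sum_congr rfl fun i _ => ?_
    rw [← Finset.sum_add_distrib]
    refine Finset.sum_congr rfl fun j _ => ?_
    push_cast
    ring
  -- (2) the difference `g(t) - g(-t)` in terms of sines
  have hdiff : ∀ t : ℝ, g t - g (-t) = ∑ i, ∑ j, ((p i + p j : ℝ) : ℂ) * (A' i j * B' j i) *
      (2 * I * (Real.sin ((E i - E j) * t) : ℂ)) := by
    intro t
    rw [hg_eq t, hg_eq (-t), ← Finset.sum_sub_distrib]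
    refine Finset.sum_congr rfl fun i _ => ?_
    rw [← Finset.sum_sub_distrib]
    refine Finset.sum_congr rfl fun j _ => ?_
    have hx := exp_I_mul_sub_exp_I_mul_neg (t * (E i - E j))
    have e1 : I * ↑t * ((E i : ℂ) - E j) = I * ((t * (E i - E j) : ℝ) : ℂ) := by push_cast; ring
    have e2 : I * ((-t : ℝ) : ℂ) * ((E i : ℂ) - E j) = I * (-(((t * (E i - E j) : ℝ)) : ℂ)) := by
      push_cast; ring
    rw [e1, e2, mul_comm (E i - E j) t, ← hx]
    ring
  -- (3) integrability
  have hint_ij : ∀ i j, IntegrableOn (fun t : ℝ => ((K t * Real.sin ((E i - E j) * t) : ℝ) : ℂ))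
      (Ioi 0) := fun i j => (integrableOn_matsubaraKernel_mul_sin ha (E i - E j)).ofReal
  have hfun : (fun t : ℝ => (K t : ℂ) * (g t - g (-t))) = fun t => ∑ i, ∑ j,
      ((p i + p j : ℝ) : ℂ) * (A' i j * B' j i) * (2 * I) *
        ((K t * Real.sin ((E i - E j) * t) : ℝ) : ℂ) := by
    funext t
    rw [hdiff t, Finset.mul_sum]
    refine Finset.sum_congr rfl fun i _ => ?_
    rw [Finset.mul_sum]
    refine Finset.sum_congr rfl fun j _ => ?_
    push_cast
    ring
  have hInt : IntegrableOn (fun t : ℝ => (K t : ℂ) * (g t - g (-t))) (Ioi 0) := by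
    rw [hfun]
    refine integrable_finsetSum _ fun i _ => integrable_finsetSum _ fun j _ => ?_
    exact (hint_ij i j).const_mul _
  refine ⟨hInt, ?_⟩
  -- (4) the value of the integral
  have hval : ∫ t in Ioi (0 : ℝ), (K t : ℂ) * (g t - g (-t)) =
      ∑ i, ∑ j, ((p i + p j : ℝ) : ℂ) * (A' i j * B' j i) * (2 * I) * (V i j : ℂ) := by
    rw [hfun, integral_finsetSum _ (fun i _ => integrable_finsetSum _ fun j _ =>
      (hint_ij i j).const_mul _)]
    refine Finset.sum_congr rfl fun i _ => ?_
    rw [integral_finsetSum _ (fun j _ => (hint_ij i j).const_mul _)]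
    refine Finset.sum_congr rfl fun j _ => ?_
    rw [integral_const_mul, integral_complex_ofReal, hKV i j]
  -- (5) the two traces as double sums
  have hLHS : (gibbsWeight β H * (A * B)).trace = ∑ i, ∑ j, (p i : ℂ) * (A' i j * B' j i) := by
    rw [hH.gibbsWeight_eq β, ← hU, trace_unitary_conj_mul, star_unitary_mul_mul_mul hUm,
      ← Matrix.mul_assoc, trace_diagonal_mul_mul]
    refine Finset.sum_congr rfl fun i _ => Finset.sum_congr rfl fun j _ => ?_
    ring
  have hanti : (gibbsWeight β H * (A * B + B * A)).trace =
      ∑ i, ∑ j, ((p i + p j : ℝ) : ℂ) * (A' i j * B' j i) := by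
    have h0 := hg_eq 0
    simp only [hg, heisenbergEvolution_zero] at h0
    rw [h0]
    refine Finset.sum_congr rfl fun i _ => Finset.sum_congr rfl fun j _ => ?_
    simp
  -- (6) assemble, pair by pair
  have hIβ : I / β * (2 * I) * ((β / 2 : ℝ) : ℂ) = -1 := by
    have hβ0 : (β : ℂ) ≠ 0 := Complex.ofReal_ne_zero.2 hβ.ne'
    have : I / β * (2 * I) * ((β / 2 : ℝ) : ℂ) = I * I * ((β : ℂ) / β) := by push_cast; ring
    rw [this, div_self hβ0, Complex.I_mul_I, mul_one]
  rw [hval, hLHS, hanti, Finset.mul_sum, Finset.mul_sum, ← Finset.sum_add_distrib]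
  refine Finset.sum_congr rfl fun i _ => ?_
  rw [Finset.mul_sum, Finset.mul_sum, ← Finset.sum_add_distrib]
  refine Finset.sum_congr rfl fun j _ => ?_
  have hF := boltzmann_fermi_identity β (E i) (E j)
  have hFC : ((p i + p j : ℝ) : ℂ) * (1 / 2 - ((1 / 2 - 1 / (1 + Real.exp (β * (E i - E j))) : ℝ) : ℂ)) =
      (p i : ℂ) := by
    have : ((p i + p j : ℝ) : ℂ) * (((1 / (1 + Real.exp (β * (E i - E j)))) : ℝ) : ℂ) = (p i : ℂ) := by
      exact_mod_cast hF
    rw [← this]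
    push_cast
    ring
  have hVsplit : (V i j : ℂ) = ((β / 2 : ℝ) : ℂ) *
      ((1 / 2 - 1 / (1 + Real.exp (β * (E i - E j))) : ℝ) : ℂ) := by
    simp only [hV]
    push_cast
    ring
  rw [hVsplit]
  linear_combination (-(A' i j * B' j i)) * hFC +
    (-(((p i + p j : ℝ) : ℂ) * (A' i j * B' j i) *
      ((1 / 2 - 1 / (1 + Real.exp (β * (E i - E j))) : ℝ) : ℂ))) * hIβ

end Spectral

/-! ### Block P: the fermion parity twist and the Lieb–Robinson bound for anticommutators -/

section Parity

open Matrix Complex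
open scoped Matrix.Norms.L2Operator

variable {ι : Type*} [LinearOrder ι] [Fintype ι]

/-- `c†_i` is odd under the fermion parity: `(-1)^N c†_i = -c†_i (-1)^N` (adjoint of
`parityOp_mul_annihilation`). [folklore] -/
theorem parityOp_mul_creation (i : ι) :
    parityOp * creation i = -(creation i * parityOp) := by
  have h := congrArg Matrix.conjTranspose (parityOp_mul_annihilation_holds (ι := ι) i)
  rw [conjTranspose_mul, conjTranspose_neg, conjTranspose_mul, annihilation_conjTranspose,
    JWSplit.parityOp_conjTranspose] at h
  rw [h, neg_neg]

/-- Every Jordan–Wigner generator is odd under the fermion parity. [folklore] -/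
theorem parityOp_mul_letterOp (l : JWLetter ι) :
    parityOp * letterOp l = -(letterOp l * parityOp) := by
  obtain ⟨i, b⟩ := l
  cases b
  · simpa [letterOp] using parityOp_mul_annihilation_holds (ι := ι) i
  · simpa [letterOp] using parityOp_mul_creation i

/-- **Even elements commute with the fermion parity**: the even CAR subalgebra (generated by
products of two generators) lies in the centraliser of `(-1)^N`. [folklore] -/
theorem commute_parityOp_of_mem_carEvenSubalgebra {S : Finset ι}
    {a : Matrix (Finset ι) (Finset ι) ℂ} (ha : a ∈ carEvenSubalgebra S) :
    Commute parityOp a := by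
  have hle : carEvenSubalgebra S ≤
      Subalgebra.centralizer ℂ {(parityOp : Matrix (Finset ι) (Finset ι) ℂ)} := by
    refine Algebra.adjoin_le ?_
    rintro _ ⟨l, l', -, -, rfl⟩
    rw [SetLike.mem_coe, Subalgebra.mem_centralizer_iff]
    intro g hg
    rw [Set.mem_singleton_iff] at hg
    subst hg
    show parityOp * (letterOp l * letterOp l') = letterOp l * letterOp l' * parityOp
    rw [← Matrix.mul_assoc, parityOp_mul_letterOp, neg_mul, Matrix.mul_assoc,
      parityOp_mul_letterOp, mul_neg, neg_neg, Matrix.mul_assoc]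
  exact (Subalgebra.mem_centralizer_iff ℂ).1 (hle ha) _ (Set.mem_singleton _)

/-- The fermion parity is unitary (`Pᴴ = P`, `P² = 1`). [folklore] -/
theorem parityOp_mem_unitary :
    (parityOp : Matrix (Finset ι) (Finset ι) ℂ) ∈ unitary (Matrix (Finset ι) (Finset ι) ℂ) := by
  rw [Unitary.mem_iff, star_eq_conjTranspose, JWSplit.parityOp_conjTranspose]
  exact ⟨JWSplit.parityOp_mul_parityOp, JWSplit.parityOp_mul_parityOp⟩

/-- Right multiplication by the fermion parity is isometric (C⋆-norm). [folklore] -/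
theorem norm_mul_parityOp (M : Matrix (Finset ι) (Finset ι) ℂ) : ‖M * parityOp‖ = ‖M‖ :=
  CStarRing.norm_mul_mem_unitary M parityOp_mem_unitary

/-- An odd observable stays odd under an even dynamics: if `P` commutes with `H` and
`P A = -A P` then `P τ_s(A) = -τ_s(A) P`. [folklore] -/
theorem parityOp_mul_heisenbergEvolution {H A : Matrix (Finset ι) (Finset ι) ℂ}
    (hPH : Commute parityOp H) (hPA : parityOp * A = -(A * parityOp)) (s : ℝ) :
    parityOp * heisenbergEvolution H s A = -(heisenbergEvolution H s A * parityOp) := by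
  have h1 : Commute parityOp (NormedSpace.exp ((I * s) • H)) := (hPH.smul_right _).exp_right
  have h2 : Commute parityOp (NormedSpace.exp ((-(I * s)) • H)) := (hPH.smul_right _).exp_right
  simp only [heisenbergEvolution]
  calc parityOp * (NormedSpace.exp ((I * s) • H) * A * NormedSpace.exp ((-(I * s)) • H))
      = parityOp * NormedSpace.exp ((I * s) • H) * A * NormedSpace.exp ((-(I * s)) • H) := by
        simp only [Matrix.mul_assoc]
    _ = NormedSpace.exp ((I * s) • H) * (parityOp * A) * NormedSpace.exp ((-(I * s)) • H) := by
        rw [h1.eq]; simp only [Matrix.mul_assoc]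
    _ = -(NormedSpace.exp ((I * s) • H) * A * (parityOp * NormedSpace.exp ((-(I * s)) • H))) := by
        rw [hPA]; simp only [Matrix.mul_neg, Matrix.neg_mul, Matrix.mul_assoc]
    _ = -(NormedSpace.exp ((I * s) • H) * A * NormedSpace.exp ((-(I * s)) • H) * parityOp) := by
        rw [h2.eq]; simp only [Matrix.mul_assoc]

/-- **The parity twist**: for `X` odd, `[X, B P] = {X, B} P`. This is how "commutators are
replaced by anti-commutators throughout" (Hastings). [cite: HastingsPRL2004FermiDecay, before eq. (10)] -/
theorem commutator_mul_parityOp_eq {X B : Matrix (Finset ι) (Finset ι) ℂ}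
    (hPX : parityOp * X = -(X * parityOp)) :
    X * (B * parityOp) - B * parityOp * X = (X * B + B * X) * parityOp := by
  rw [Matrix.mul_assoc B parityOp X, hPX, Matrix.mul_neg, sub_neg_eq_add, add_mul,
    Matrix.mul_assoc, Matrix.mul_assoc]

variable {Λ : Type*} [LinearOrder Λ] [Fintype Λ] (G : SimpleGraph Λ) [DecidableRel G.Adj]

/-- The Hubbard Hamiltonian `H(t,U) - μN` is even: it commutes with the fermion parity.
[folklore] -/
theorem commute_parityOp_hamiltonianWith (t U μ : ℝ) :
    Commute parityOp (hamiltonianWith G t U μ) := by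
  rw [← sum_hubbardTermOp G t U μ]
  exact Commute.sum_right _ _ _ fun Z _ =>
    commute_parityOp_of_mem_carEvenSubalgebra (hubbardTermOp_mem_carEvenSubalgebra G t U μ Z)

/-- **Lieb–Robinson bound for ANTICOMMUTATORS of odd lattice fermion operators** (Hubbard model
`H(t,U) - μN` on a finite graph of maximal degree `≤ Δ`): for `A` in the CAR algebra of the sites
`X`, `B` in that of the sites `Y`, both odd under the fermion parity, and any `δ : Λ → ℕ`
vanishing on `Y` and `1`-Lipschitz along edges, for `s ≥ 0`, with `J = 2|t| + |U| + 2|μ|`,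
`D = 2(2Δ+1)`,
`‖{τ_s(A), B}‖ ≤ ‖{A, B}‖ + 2‖A‖ Σ_{Z : supp Z ∩ X ≠ ∅} 2J‖B‖ s e^{2eJD s - ℓ(Z)}`.
Hastings: "for fermionic operators, a similar bound can be proven:
`‖{A(t),B}‖ ≤ ‖A‖‖B‖ Σ_j g(t,l_j)`. This proof can be proven following the same steps as in [lhd]
with commutators replaced by anti-commutators throughout" — here realised by the parity twist
`‖{τ_s(A), B}‖ = ‖[τ_s(A), B P]‖` (`P = (-1)^N` commutes with the even terms of `H`) and the
tree's `lieb_robinson_abstract`. [cite: HastingsPRL2004FermiDecay, paragraph before eq. (10)] -/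
theorem fermion_lieb_robinson_anticommutator {Δ : ℕ}
    (hΔ : ∀ x : Λ, (Finset.univ.filter fun y => G.Adj x y).card ≤ Δ) (t U μ : ℝ)
    {X Y : Finset Λ} {A B : Matrix (Finset (Orb Λ)) (Finset (Orb Λ)) ℂ}
    (hA : A ∈ carSubalgebra (orbSet X)) (hB : B ∈ carSubalgebra (orbSet Y))
    (hAodd : parityOp * A = -(A * parityOp))
    (δ : Λ → ℕ) (hδY : ∀ y ∈ Y, δ y = 0) (hδ : ∀ x y, G.Adj x y → δ x ≤ δ y + 1)
    {s : ℝ} (hs : 0 ≤ s) :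
    ‖heisenbergEvolution (hamiltonianWith G t U μ) s A * B +
        B * heisenbergEvolution (hamiltonianWith G t U μ) s A‖ ≤
      ‖A * B + B * A‖ + 2 * ‖A‖ *
        ∑ Z ∈ Finset.univ.filter (fun Z : HubbardIdx G => ¬ Disjoint (hubbardTermSupp G Z) X),
          2 * (2 * |t| + |U| + 2 * |μ|) * ‖B‖ * s *
            Real.exp (Real.exp 1 * (2 * (2 * |t| + |U| + 2 * |μ|) * (2 * (2 * Δ + 1) : ℕ)) * s -
              ((hubbardTermSupp G Z).inf' (hubbardTermSupp_nonempty G Z) δ : ℕ)) := by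
  classical
  have hPH := commute_parityOp_hamiltonianWith G t U μ
  have hPτ : parityOp * heisenbergEvolution (hamiltonianWith G t U μ) s A =
      -(heisenbergEvolution (hamiltonianWith G t U μ) s A * parityOp) :=
    parityOp_mul_heisenbergEvolution hPH hAodd s
  -- the commutator bound for the twisted observable `B P`
  have key : ‖heisenbergEvolution (hamiltonianWith G t U μ) s A * (B * parityOp) -
        B * parityOp * heisenbergEvolution (hamiltonianWith G t U μ) s A‖ ≤
      ‖A * (B * parityOp) - B * parityOp * A‖ + 2 * ‖A‖ *
        ∑ Z ∈ Finset.univ.filter (fun Z : HubbardIdx G => ¬ Disjoint (hubbardTermSupp G Z) X),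
          2 * (2 * |t| + |U| + 2 * |μ|) * ‖B * parityOp‖ * s *
            Real.exp (Real.exp 1 * (2 * (2 * |t| + |U| + 2 * |μ|) * (2 * (2 * Δ + 1) : ℕ)) * s -
              ((hubbardTermSupp G Z).inf' (hubbardTermSupp_nonempty G Z) δ : ℕ)) := by
    rw [← sum_hubbardTermOp G t U μ]
    refine lieb_robinson_abstract (hubbardTermOp G t U μ) (isHermitian_hubbardTermOp G t U μ)
      (fun Z' Z => ¬ Disjoint (hubbardTermSupp G Z') (hubbardTermSupp G Z)) ?_
      (by positivity) (norm_hubbardTermOp_le G t U μ) ?_ (B * parityOp)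
      (fun Z => (hubbardTermSupp G Z).inf' (hubbardTermSupp_nonempty G Z) δ) ?_ ?_ A _ ?_ hs
    · -- non-touching terms commute
      intro Z Z' hZZ'
      rw [not_not] at hZZ'
      exact commute_hubbardTermOp_of_disjoint G t U μ Z'
        ((carEvenSubalgebra_le_carSubalgebra _) (hubbardTermOp_mem_carEvenSubalgebra G t U μ Z)) hZZ'
    · -- at most `2(2Δ+1)` terms touch a given term
      intro Z
      refine (card_filter_not_disjoint_hubbardTermSupp_le G hΔ _).trans ?_
      have hcard : (hubbardTermSupp G Z).card ≤ 2 := by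
        cases Z with
        | inl p => exact Finset.card_insert_le _ _ |>.trans (by simp)
        | inr x => simp [hubbardTermSupp]
      calc (hubbardTermSupp G Z).card * (2 * Δ + 1) ≤ 2 * (2 * Δ + 1) := Nat.mul_le_mul_right _ hcard
        _ = (2 * (2 * Δ + 1) : ℕ) := rfl
    · -- terms at positive level do not meet `Y`: they commute with `B`, and (being even) with `P`
      intro Z hZ
      refine Commute.mul_right ?_
        (commute_parityOp_of_mem_carEvenSubalgebra (hubbardTermOp_mem_carEvenSubalgebra G t U μ Z)).symm
      refine commute_hubbardTermOp_of_disjoint G t U μ Z hB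
        (Finset.disjoint_left.2 fun z hzZ hzY => hZ ?_)
      exact Nat.eq_zero_of_le_zero ((Finset.inf'_le δ hzZ).trans (hδY z hzY).le)
    · -- the level drops by at most one along touching terms
      intro Z Z' hZZ'
      obtain ⟨w, hwZ', hwZ⟩ := Finset.not_disjoint_iff.1 hZZ'
      obtain ⟨z', hz', hmin⟩ := Finset.exists_mem_eq_inf' (hubbardTermSupp_nonempty G Z') δ
      rw [hmin]
      refine (Finset.inf'_le δ hwZ).trans ?_
      rcases eq_or_adj_of_mem_hubbardTermSupp G hwZ' hz' with h | h
      · rw [h]; exact Nat.le_succ _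
      · exact hδ w z' h
    · -- terms not meeting `X` commute with `A`
      intro Z hZ
      rw [Finset.mem_filter, not_and, not_not] at hZ
      exact commute_hubbardTermOp_of_disjoint G t U μ Z hA (hZ (Finset.mem_univ _))
  rw [commutator_mul_parityOp_eq hPτ, commutator_mul_parityOp_eq hAodd] at key
  simpa only [norm_mul_parityOp] using key

/-- Time reversal for anticommutators: `‖{τ_{-s}(A), B}‖ = ‖{τ_s(B), A}‖`
(`τ_{-s}` is an isometric automorphism). [folklore] -/
theorem norm_anticommutator_heisenbergEvolution_neg {m : Type*} [Fintype m] [DecidableEq m]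
    {H : Matrix m m ℂ} (hH : H.IsHermitian) (s : ℝ) (A B : Matrix m m ℂ) :
    ‖heisenbergEvolution H (-s) A * B + B * heisenbergEvolution H (-s) A‖ =
      ‖heisenbergEvolution H s B * A + A * heisenbergEvolution H s B‖ := by
  have h1 : heisenbergEvolution H (-s) (heisenbergEvolution H s B) = B := by
    rw [← heisenbergEvolution_add, neg_add_cancel, heisenbergEvolution_zero]
  have hev : heisenbergEvolution H (-s) A * B + B * heisenbergEvolution H (-s) A =
      heisenbergEvolution H (-s) (A * heisenbergEvolution H s B + heisenbergEvolution H s B * A) := by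
    rw [show heisenbergEvolution H (-s) (A * heisenbergEvolution H s B + heisenbergEvolution H s B * A) =
        heisenbergEvolution H (-s) (A * heisenbergEvolution H s B) +
          heisenbergEvolution H (-s) (heisenbergEvolution H s B * A) by
      simp only [heisenbergEvolution, Matrix.mul_add, Matrix.add_mul],
      heisenbergEvolution_mul, heisenbergEvolution_mul, h1]
  rw [hev, norm_heisenbergEvolution_holds hH, add_comm]

end Parity

/-! ### Block G: the torus `(ℤ/Lℤ)²` — degrees and the distance level function -/

section Torus

open Finset Literature.Probability.LatticeModels
open scoped Matrix.Norms.L2Operator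

variable {L : ℕ} [NeZero L]

/-- Every site of the fermionic torus graph `(ℤ/Lℤ)²` has at most `4` neighbours (local copy, for
`d = 2`, of `card_filter_fermionTorusGraph_adj_le` of `HubbardLSMFillingProofs.lean`, whose import
chain is not wanted here). [folklore] -/
private theorem card_filter_adj_fermionTorus_two_le (v : FermionTorus 2 L) :
    (univ.filter fun w : FermionTorus 2 L => (fermionTorusGraph 2 L).Adj v w).card ≤ 4 := by
  have hinj : Function.Injective (FermionTorus.toTorusSite : FermionTorus 2 L → TorusSite 2 L) :=
    FermionTorus.equivTorusSite.injective
  calc (univ.filter fun w : FermionTorus 2 L => (fermionTorusGraph 2 L).Adj v w).card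
      = ((univ.filter fun w : FermionTorus 2 L => (fermionTorusGraph 2 L).Adj v w).image
          FermionTorus.toTorusSite).card := (card_image_of_injective _ hinj).symm
    _ ≤ (univ.filter fun u : TorusSite 2 L =>
          (torusGraph 2 L).Adj (FermionTorus.toTorusSite v) u).card := by
        refine card_le_card fun u hu => ?_
        obtain ⟨w, hw, rfl⟩ := mem_image.1 hu
        rw [mem_filter] at hw ⊢
        exact ⟨mem_univ _, (fermionTorusGraph_adj v w).1 hw.2⟩
    _ ≤ 2 * 2 := card_filter_adj_le _
    _ = 4 := rfl

/-- The torus distance to a fixed site `y`, pulled back to the fermionic torus, vanishes at `y`.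
[folklore] -/
theorem torusDist_toTorusSite_eq_zero (y : TorusSite 2 L) :
    ∀ z ∈ ({FermionTorus.ofTorusSite y} : Finset (FermionTorus 2 L)),
      torusDist (FermionTorus.toTorusSite z) y = 0 := by
  intro z hz
  rw [Finset.mem_singleton] at hz
  subst hz
  rw [FermionTorus.toTorusSite_ofTorusSite, torusDist_self]

/-- The torus distance to a fixed site is `1`-Lipschitz along the edges of the fermionic torus
graph. [folklore] -/
theorem torusDist_toTorusSite_le_of_adj (y : TorusSite 2 L) (z w : FermionTorus 2 L)
    (h : (fermionTorusGraph 2 L).Adj z w) :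
    torusDist (FermionTorus.toTorusSite z) y ≤ torusDist (FermionTorus.toTorusSite w) y + 1 := by
  have h1 := torusDist_le_one_of_adj ((fermionTorusGraph_adj z w).1 h)
  have h2 := torusDist_triangle' (FermionTorus.toTorusSite z) (FermionTorus.toTorusSite w) y
  omega

/-- The level of a Hubbard term meeting the site `x`: at least `dist(x, y) - 1`. [folklore] -/
theorem torusDist_le_level_add_one (x y : TorusSite 2 L)
    (Z : HubbardIdx (fermionTorusGraph 2 L))
    (hZ : ¬ Disjoint (hubbardTermSupp (fermionTorusGraph 2 L) Z)
      ({FermionTorus.ofTorusSite x} : Finset (FermionTorus 2 L))) :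
    torusDist x y ≤ (hubbardTermSupp (fermionTorusGraph 2 L) Z).inf'
      (hubbardTermSupp_nonempty (fermionTorusGraph 2 L) Z)
        (fun z => torusDist (FermionTorus.toTorusSite z) y) + 1 := by
  obtain ⟨w, hwZ, hwx⟩ := not_disjoint_iff.1 hZ
  rw [Finset.mem_singleton] at hwx
  subst hwx
  obtain ⟨z', hz', hmin⟩ := exists_mem_eq_inf'
    (hubbardTermSupp_nonempty (fermionTorusGraph 2 L) Z) (fun z => torusDist (FermionTorus.toTorusSite z) y)
  rw [hmin]
  rcases eq_or_adj_of_mem_hubbardTermSupp (fermionTorusGraph 2 L) hwZ hz' with h | h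
  · subst h
    rw [FermionTorus.toTorusSite_ofTorusSite]
    exact Nat.le_succ _
  · have := torusDist_toTorusSite_le_of_adj y _ _ h
    rwa [FermionTorus.toTorusSite_ofTorusSite] at this

/-- **The anticommutator Lieb–Robinson bound on the Hubbard torus, in closed form**: for `A` in the
CAR algebra of the site `x` and `B` in that of the site `y` of `(ℤ/Lℤ)²`, `A` odd, both of norm
`≤ 1`, and `s ≥ 0`,
`‖{τ_s(A), B}‖ ≤ ‖{A, B}‖ + 36 J e · s · e^{κ s - dist(x,y)}`, `J = 2 + |U| + 2|μ|`, `κ = 36eJ`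
(the `≤ 9` terms of `H` meeting `x` have level `≥ dist(x,y) - 1`; degree `≤ 4`).
[cite: HastingsPRL2004FermiDecay, paragraph before eq. (10)] -/
theorem norm_anticommutator_hubbardTorus_le [instDE : DecidableEq (FermionTorus 2 L)]
    (U μ : ℝ) (x y : TorusSite 2 L)
    {A B : Matrix (Finset (Orb (FermionTorus 2 L))) (Finset (Orb (FermionTorus 2 L))) ℂ}
    (hA : A ∈ carSubalgebra (orbSet ({FermionTorus.ofTorusSite x} : Finset (FermionTorus 2 L))))
    (hB : B ∈ carSubalgebra (orbSet ({FermionTorus.ofTorusSite y} : Finset (FermionTorus 2 L))))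
    (hAodd : parityOp * A = -(A * parityOp)) (hA1 : ‖A‖ ≤ 1) (hB1 : ‖B‖ ≤ 1)
    {s : ℝ} (hs : 0 ≤ s) :
    ‖heisenbergEvolution (hubbardTorusWith 2 L 1 U μ) s A * B +
        B * heisenbergEvolution (hubbardTorusWith 2 L 1 U μ) s A‖ ≤
      ‖A * B + B * A‖ + 36 * (2 * |(1 : ℝ)| + |U| + 2 * |μ|) * Real.exp 1 * s *
        Real.exp (Real.exp 1 * (2 * (2 * |(1 : ℝ)| + |U| + 2 * |μ|) * (2 * (2 * 4 + 1) : ℕ)) * s -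
          torusDist x y) := by
  -- Replace the ambient `DecidableEq (FermionTorus 2 L)` instance (through which every matrix
  -- unit, norm and exponential in sight is elaborated) by the one carried by the generic lemmas,
  -- `LinearOrder.toDecidableEq`; the two agree by `Subsingleton.elim` (cf. the same device in
  -- `HubbardHubbardModelKomaTasakiProofs.norm_gibbsState_hubbardTorusWith_le`).
  obtain rfl : instDE = LinearOrder.toDecidableEq := Subsingleton.elim _ _
  letI instDE : DecidableEq (FermionTorus 2 L) := LinearOrder.toDecidableEq
  set J : ℝ := 2 * |(1 : ℝ)| + |U| + 2 * |μ| with hJ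
  set κ : ℝ := Real.exp 1 * (2 * J * (2 * (2 * 4 + 1) : ℕ)) with hκ
  have hJ0 : 0 ≤ J := by positivity
  have hLR := fermion_lieb_robinson_anticommutator (fermionTorusGraph 2 L)
    card_filter_adj_fermionTorus_two_le 1 U μ hA hB hAodd
    (fun z => torusDist (FermionTorus.toTorusSite z) y) (torusDist_toTorusSite_eq_zero y)
    (torusDist_toTorusSite_le_of_adj y) hs
  refine hLR.trans (add_le_add le_rfl ?_)
  rw [← hJ, ← hκ]
  -- each of the `≤ 9` terms is bounded by `2J s e^{κ s - dist(x,y) + 1}`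
  have hterm : ∀ Z ∈ univ.filter (fun Z : HubbardIdx (fermionTorusGraph 2 L) =>
      ¬ Disjoint (hubbardTermSupp (fermionTorusGraph 2 L) Z) {FermionTorus.ofTorusSite x}),
      2 * J * ‖B‖ * s * Real.exp (κ * s -
        ((hubbardTermSupp (fermionTorusGraph 2 L) Z).inf'
          (hubbardTermSupp_nonempty (fermionTorusGraph 2 L) Z)
            (fun z => torusDist (FermionTorus.toTorusSite z) y) : ℕ)) ≤
        2 * J * s * Real.exp (κ * s - torusDist x y + 1) := by
    intro Z hZ
    rw [mem_filter] at hZ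
    have hlev := torusDist_le_level_add_one x y Z hZ.2
    have hlev' : (torusDist x y : ℝ) ≤ ((hubbardTermSupp (fermionTorusGraph 2 L) Z).inf'
        (hubbardTermSupp_nonempty (fermionTorusGraph 2 L) Z)
          (fun z => torusDist (FermionTorus.toTorusSite z) y) : ℕ) + 1 := by
      exact_mod_cast hlev
    calc 2 * J * ‖B‖ * s * Real.exp (κ * s - ((hubbardTermSupp (fermionTorusGraph 2 L) Z).inf'
          (hubbardTermSupp_nonempty (fermionTorusGraph 2 L) Z)
            (fun z => torusDist (FermionTorus.toTorusSite z) y) : ℕ))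
        ≤ 2 * J * 1 * s * Real.exp (κ * s - torusDist x y + 1) := by
          gcongr
          linarith
      _ = 2 * J * s * Real.exp (κ * s - torusDist x y + 1) := by ring
  have hcard := card_filter_not_disjoint_hubbardTermSupp_le (fermionTorusGraph 2 L)
    card_filter_adj_fermionTorus_two_le ({FermionTorus.ofTorusSite x} : Finset (FermionTorus 2 L))
  rw [Finset.card_singleton, one_mul] at hcard
  calc 2 * ‖A‖ * ∑ Z ∈ univ.filter (fun Z : HubbardIdx (fermionTorusGraph 2 L) =>
        ¬ Disjoint (hubbardTermSupp (fermionTorusGraph 2 L) Z) {FermionTorus.ofTorusSite x}),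
        2 * J * ‖B‖ * s * Real.exp (κ * s -
          ((hubbardTermSupp (fermionTorusGraph 2 L) Z).inf'
            (hubbardTermSupp_nonempty (fermionTorusGraph 2 L) Z)
              (fun z => torusDist (FermionTorus.toTorusSite z) y) : ℕ))
      ≤ 2 * 1 * ∑ _Z ∈ univ.filter (fun Z : HubbardIdx (fermionTorusGraph 2 L) =>
        ¬ Disjoint (hubbardTermSupp (fermionTorusGraph 2 L) Z) {FermionTorus.ofTorusSite x}),
        2 * J * s * Real.exp (κ * s - torusDist x y + 1) := by
        refine mul_le_mul (mul_le_mul_of_nonneg_left hA1 zero_le_two) (sum_le_sum hterm)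
          (sum_nonneg fun Z _ => by positivity) (by norm_num)
    _ ≤ 2 * 1 * ((2 * 4 + 1 : ℕ) * (2 * J * s * Real.exp (κ * s - torusDist x y + 1))) := by
        rw [sum_const, nsmul_eq_mul]
        refine mul_le_mul_of_nonneg_left (mul_le_mul_of_nonneg_right ?_ (by positivity))
          (by norm_num)
        exact_mod_cast hcard
    _ = 36 * J * Real.exp 1 * s * Real.exp (κ * s - torusDist x y) := by
        rw [show κ * s - torusDist x y + 1 = (κ * s - torusDist x y) + 1 by ring, Real.exp_add]
        push_cast
        ring

end Torus

/-! ### Assembly: Hastings' estimate (12)–(13) for `⟨c†_{xσ} c_{yσ}⟩_β` on the Hubbard torus -/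

section Assembly

open Matrix Complex Finset Literature.Probability.LatticeModels
open scoped Matrix.Norms.L2Operator

/-- `u e^{-u/2} ≤ (4/e) e^{-u/4}` (from `x + 1 ≤ eˣ` at `x = u/4 - 1`). [folklore] -/
theorem mul_exp_neg_half_le (u : ℝ) :
    u * Real.exp (-u / 2) ≤ 4 / Real.exp 1 * Real.exp (-u / 4) := by
  have h1 : u / 4 ≤ Real.exp (u / 4 - 1) := by
    have := Real.add_one_le_exp (u / 4 - 1); linarith
  rw [Real.exp_sub] at h1
  have hE := Real.exp_pos (-u / 2)
  have he := Real.exp_pos (1 : ℝ)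
  calc u * Real.exp (-u / 2) = 4 * (u / 4) * Real.exp (-u / 2) := by ring
    _ ≤ 4 * (Real.exp (u / 4) / Real.exp 1) * Real.exp (-u / 2) := by gcongr
    _ = 4 / Real.exp 1 * (Real.exp (u / 4) * Real.exp (-u / 2)) := by ring
    _ = 4 / Real.exp 1 * Real.exp (-u / 4) := by rw [← Real.exp_add]; congr 1; congr 1; ring

set_option maxHeartbeats 400000 in
/-- **Hastings' bound for the thermal one-body density matrix of the Hubbard torus, one volume at
a time, with explicit constants** (`J = 2 + |U| + 2|μ|`, `κ = 36eJ` the Lieb–Robinson rate,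
`c₁ = 1/(2κ)`): for `β ≥ 1`,
`|⟨c†_{xσ} c_{yσ}⟩_{β,L,U,μ}| ≤ (e + C₁(U,μ)) exp(-c₀(U,μ) dist(x,y)/β)`,
`c₀ = min(1/4, π/(2κ))`. Proof = Hastings' eqs. (10)–(13): `{c†_x, c_y} = 0`, the integral
representation (`hastings_integral_representation`), the split `∫₀^{c₁l} + ∫_{c₁l}^∞` with
`k(t) ≤ β/(2πt)` and the anticommutator Lieb–Robinson bound on `[0, c₁l]`
(`norm_anticommutator_hubbardTorus_le`), `‖{A(±t),B}‖ ≤ 2` and `k(t) ≤ e^{-πt/β}/(1 - e^{-2})`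
beyond; the trivial bound `|⟨AB⟩| ≤ 1` when `πc₁l/β < 1`. Stated for an arbitrary
`DecidableEq (FermionTorus 2 L)` instance (see `norm_anticommutator_hubbardTorus_le`).
[cite: HastingsPRL2004FermiDecay, eqs. (10)–(13)] -/
theorem norm_gibbsState_creation_annihilation_le (U μ β : ℝ) (L : ℕ) [NeZero L]
    [instDE : DecidableEq (FermionTorus 2 L)] (hβ : 1 ≤ β) (x y : TorusSite 2 L) (σ : Fin 2) :
    ‖(hubbardTorusWith 2 L 1 U μ).gibbsState β
        ((annihilation (orb (FermionTorus.ofTorusSite x) σ))ᴴ *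
          annihilation (orb (FermionTorus.ofTorusSite y) σ))‖ ≤
      (Real.exp 1 +
        (36 * (2 * |(1 : ℝ)| + |U| + 2 * |μ|) * Real.exp 1 / Real.pi *
            (1 / (2 * (Real.exp 1 * (2 * (2 * |(1 : ℝ)| + |U| + 2 * |μ|) * (2 * (2 * 4 + 1) : ℕ))))) *
            (4 / Real.exp 1) +
          4 / (Real.pi * (1 - Real.exp (-2))))) *
        Real.exp (-(min (1 / 4 : ℝ) (Real.pi / (2 * (Real.exp 1 * (2 * (2 * |(1 : ℝ)| + |U| + 2 * |μ|) *
          (2 * (2 * 4 + 1) : ℕ))))) * (torusDist x y : ℝ) / β)) := by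
  -- instance bookkeeping (see `norm_anticommutator_hubbardTorus_le`)
  obtain rfl : instDE = LinearOrder.toDecidableEq := Subsingleton.elim _ _
  letI instDE : DecidableEq (FermionTorus 2 L) := LinearOrder.toDecidableEq
  -- constants
  set J : ℝ := 2 * |(1 : ℝ)| + |U| + 2 * |μ| with hJ
  set κ : ℝ := Real.exp 1 * (2 * J * (2 * (2 * 4 + 1) : ℕ)) with hκ
  set K₁ : ℝ := 36 * J * Real.exp 1 with hK₁
  set c₀ : ℝ := min (1 / 4 : ℝ) (Real.pi / (2 * κ)) with hc₀
  set C₁ : ℝ := K₁ / Real.pi * (1 / (2 * κ)) * (4 / Real.exp 1) +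
    4 / (Real.pi * (1 - Real.exp (-2))) with hC₁
  have hJpos : 0 < J := by
    have h1 : |(1 : ℝ)| = 1 := abs_one
    have := abs_nonneg U; have := abs_nonneg μ; linarith
  have hκpos : 0 < κ := by positivity
  have hK₁pos : 0 < K₁ := by positivity
  have hπ : Real.pi ≠ 0 := Real.pi_ne_zero
  have he2 : 0 < 1 - Real.exp (-2) := by
    have := Real.exp_lt_one_iff.2 (by norm_num : (-2 : ℝ) < 0); linarith
  have hc₀pos : 0 < c₀ := lt_min (by norm_num) (by positivity)
  have hc₀_le_quarter : c₀ ≤ 1 / 4 := min_le_left _ _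
  have hc₀_le : c₀ ≤ Real.pi / (2 * κ) := min_le_right _ _
  have hC₁nn : 0 ≤ C₁ := by positivity
  have hβpos : 0 < β := by linarith
  set l : ℕ := torusDist x y with hl
  set H := hubbardTorusWith 2 L 1 U μ with hH_def
  have hH : H.IsHermitian := isHermitian_hamiltonianWith (fermionTorusGraph 2 L) 1 U μ
  set xF : FermionTorus 2 L := FermionTorus.ofTorusSite x with hxF
  set yF : FermionTorus 2 L := FermionTorus.ofTorusSite y with hyF
  set A : Matrix (Finset (Orb (FermionTorus 2 L))) (Finset (Orb (FermionTorus 2 L))) ℂ :=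
    creation (orb xF σ) with hA_def
  set B : Matrix (Finset (Orb (FermionTorus 2 L))) (Finset (Orb (FermionTorus 2 L))) ℂ :=
    annihilation (orb yF σ) with hB_def
  change ‖gibbsState β H (A * B)‖ ≤ (Real.exp 1 + C₁) * Real.exp (-(c₀ * (l : ℝ) / β))
  have hA1 : ‖A‖ ≤ 1 := norm_creation_le_one _
  have hB1 : ‖B‖ ≤ 1 := norm_annihilation_le_one _
  have hAmem : A ∈ carSubalgebra (orbSet ({xF} : Finset (FermionTorus 2 L))) :=
    creation_mem_carSubalgebra (orb_mem_orbSet (Finset.mem_singleton_self xF) σ)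
  have hBmem : B ∈ carSubalgebra (orbSet ({yF} : Finset (FermionTorus 2 L))) :=
    annihilation_mem_carSubalgebra (orb_mem_orbSet (Finset.mem_singleton_self yF) σ)
  have hAodd : parityOp * A = -(A * parityOp) := parityOp_mul_creation _
  have hBodd : parityOp * B = -(B * parityOp) := parityOp_mul_annihilation_holds _
  -- the trivial bound `|⟨AB⟩| ≤ ‖A‖ ‖B‖ ≤ 1`
  have htriv : ‖gibbsState β H (A * B)‖ ≤ 1 :=
    (norm_gibbsState_le hH β _).trans ((norm_mul_le _ _).trans (mul_le_one₀ hA1 (norm_nonneg _) hB1))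
  set a : ℝ := Real.pi / β with ha_def
  have ha : 0 < a := div_pos Real.pi_pos hβpos
  by_cases hcase : a * ((l : ℝ) / (2 * κ)) < 1
  · -- separations `l < 2κβ/π`: the trivial bound suffices
    have h1 : c₀ * (l : ℝ) / β ≤ 1 := by
      calc c₀ * (l : ℝ) / β ≤ Real.pi / (2 * κ) * (l : ℝ) / β := by gcongr
        _ = a * ((l : ℝ) / (2 * κ)) := by rw [ha_def]; ring
        _ ≤ 1 := hcase.le
    calc ‖gibbsState β H (A * B)‖ ≤ 1 := htriv
      _ = Real.exp 1 * Real.exp (-1) := by rw [← Real.exp_add]; norm_num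
      _ ≤ (Real.exp 1 + C₁) * Real.exp (-(c₀ * (l : ℝ) / β)) :=
          mul_le_mul (by linarith) (Real.exp_le_exp.2 (by linarith)) (Real.exp_pos _).le
            (by positivity)
  -- separations `l ≥ 2κβ/π`: Hastings' argument
  have haT : 1 ≤ a * ((l : ℝ) / (2 * κ)) := not_lt.1 hcase
  set T : ℝ := (l : ℝ) / (2 * κ) with hT_def
  have hT : 0 < T := lt_of_mul_lt_mul_left (by linarith : a * 0 < a * T) ha.le
  have hκT : κ * T = (l : ℝ) / 2 := by rw [hT_def]; field_simp
  have hl0 : 0 < l := by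
    rcases Nat.eq_zero_or_pos l with h | h
    · exfalso; rw [h] at hT_def; simp only [hT_def, Nat.cast_zero, zero_div] at hT; exact lt_irrefl _ hT
    · exact h
  have hxy : x ≠ y := by
    intro h
    apply Nat.pos_iff_ne_zero.1 hl0
    rw [hl, h, torusDist_self]
  have horb : orb xF σ ≠ orb yF σ := by
    intro h
    apply hxy
    have h2 : xF = yF := by
      have := congrArg (fun k : Orb (FermionTorus 2 L) => (ofLex k).1) h
      simpa using this
    rw [← FermionTorus.toTorusSite_ofTorusSite x, ← FermionTorus.toTorusSite_ofTorusSite y, ← hxF,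
      ← hyF, h2]
  -- `{c†_x, c_y} = 0`
  have hAB : A * B + B * A = 0 := by
    have h := annihilation_mul_creation_add_creation_mul_annihilation_holds
      (ι := Orb (FermionTorus 2 L)) (orb yF σ) (orb xF σ)
    rw [if_neg horb.symm, add_comm] at h
    exact h
  have hBA : B * A + A * B = 0 := by rw [add_comm]; exact hAB
  -- Hastings' integral representation, eq. (9)
  obtain ⟨hInt, hrep⟩ := hastings_integral_representation hH hβpos A B
  set K : ℝ → ℝ := fun t => Real.exp (-(a * t)) / (1 - Real.exp (-(2 * (a * t)))) with hK
  set g : ℝ → ℂ := fun t =>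
    (gibbsWeight β H * (heisenbergEvolution H t A * B + B * heisenbergEvolution H t A)).trace with hg
  have hInt' : MeasureTheory.IntegrableOn (fun t : ℝ => (K t : ℂ) * (g t - g (-t))) (Set.Ioi 0) := hInt
  have hrep' : (gibbsWeight β H * (A * B)).trace =
      I / β * ∫ t in Set.Ioi (0 : ℝ), (K t : ℂ) * (g t - g (-t)) := by
    rw [hrep, hAB, Matrix.mul_zero, Matrix.trace_zero, mul_zero, zero_add]
  -- normalisation by `Z > 0`
  have hZ : partitionFn β H = ((partitionFn β H).re : ℂ) := partitionFn_eq_re hH β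
  have hZpos : 0 < (partitionFn β H).re := partitionFn_re_pos hH β
  set Z : ℝ := (partitionFn β H).re with hZ_def
  set G : ℝ → ℂ := fun t =>
    gibbsState β H (heisenbergEvolution H t A * B + B * heisenbergEvolution H t A) with hG
  have hGg : ∀ t, G t = (Z : ℂ)⁻¹ * g t := by
    intro t
    simp only [hG, hg]
    rw [gibbsState_apply, hZ]
  have hGS : gibbsState β H (A * B) = I / β * ∫ t in Set.Ioi (0 : ℝ), (K t : ℂ) * (G t - G (-t)) := by
    rw [gibbsState_apply, hrep', hZ, ← mul_assoc, mul_comm ((Z : ℂ)⁻¹) (I / β), mul_assoc,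
      ← MeasureTheory.integral_const_mul]
    congr 1
    refine MeasureTheory.setIntegral_congr_fun measurableSet_Ioi fun t _ => ?_
    rw [hGg t, hGg (-t)]
    ring
  -- pointwise bounds
  have hGle : ∀ t, ‖G t‖ ≤ ‖heisenbergEvolution H t A * B + B * heisenbergEvolution H t A‖ :=
    fun t => norm_gibbsState_le hH β _
  have hanti_triv : ∀ t, ‖heisenbergEvolution H t A * B + B * heisenbergEvolution H t A‖ ≤ 2 := by
    intro t
    calc _ ≤ ‖heisenbergEvolution H t A * B‖ + ‖B * heisenbergEvolution H t A‖ := norm_add_le _ _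
      _ ≤ ‖heisenbergEvolution H t A‖ * ‖B‖ + ‖B‖ * ‖heisenbergEvolution H t A‖ :=
          add_le_add (norm_mul_le _ _) (norm_mul_le _ _)
      _ ≤ 1 * 1 + 1 * 1 := by
          rw [norm_heisenbergEvolution_holds hH]
          gcongr
      _ = 2 := by norm_num
  have hLRpos : ∀ t, 0 ≤ t →
      ‖heisenbergEvolution H t A * B + B * heisenbergEvolution H t A‖ ≤ K₁ * t * Real.exp (κ * t - l) := by
    intro t ht
    have h := norm_anticommutator_hubbardTorus_le U μ x y hAmem hBmem hAodd hA1 hB1 ht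
    rw [hAB, norm_zero, zero_add] at h
    exact h
  have hLRneg : ∀ t, 0 ≤ t →
      ‖heisenbergEvolution H (-t) A * B + B * heisenbergEvolution H (-t) A‖ ≤
        K₁ * t * Real.exp (κ * t - l) := by
    intro t ht
    rw [norm_anticommutator_heisenbergEvolution_neg hH t A B]
    have h := norm_anticommutator_hubbardTorus_le U μ y x hBmem hAmem hBodd hB1 hA1 ht
    rw [hBA, norm_zero, zero_add, torusDist_comm' y x] at h
    exact h
  set F : ℝ → ℂ := fun t => (K t : ℂ) * (G t - G (-t)) with hF
  have hFnorm : ∀ t, 0 < t → ‖F t‖ ≤ K t *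
      (‖heisenbergEvolution H t A * B + B * heisenbergEvolution H t A‖ +
        ‖heisenbergEvolution H (-t) A * B + B * heisenbergEvolution H (-t) A‖) := by
    intro t ht
    have hKt : 0 ≤ K t := (matsubaraKernel_pos (mul_pos ha ht)).le
    calc ‖F t‖ = |K t| * ‖G t - G (-t)‖ := by
          simp only [hF, norm_mul, Complex.norm_real, Real.norm_eq_abs]
      _ ≤ K t * (‖G t‖ + ‖G (-t)‖) := by
          rw [abs_of_nonneg hKt]
          exact mul_le_mul_of_nonneg_left (norm_sub_le _ _) hKt
      _ ≤ _ := mul_le_mul_of_nonneg_left (add_le_add (hGle t) (hGle (-t))) hKt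
  -- times `t ≤ c₁ l`: `k(t) ≤ β/(2πt)` and the Lieb–Robinson bound
  have hsmall : ∀ t ∈ Set.Ioc (0 : ℝ) T, ‖F t‖ ≤ K₁ / a * Real.exp (-(l : ℝ) / 2) := by
    intro t ht
    obtain ⟨ht0, htT⟩ := ht
    have ht0' : t ≠ 0 := ht0.ne'
    have hKt := matsubaraKernel_le_inv (mul_pos ha ht0)
    refine (hFnorm t ht0).trans ?_
    calc K t * (‖heisenbergEvolution H t A * B + B * heisenbergEvolution H t A‖ +
          ‖heisenbergEvolution H (-t) A * B + B * heisenbergEvolution H (-t) A‖)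
        ≤ 1 / (2 * (a * t)) * (K₁ * t * Real.exp (κ * t - l) + K₁ * t * Real.exp (κ * t - l)) :=
          mul_le_mul hKt (add_le_add (hLRpos t ht0.le) (hLRneg t ht0.le)) (by positivity)
            (by positivity)
      _ = K₁ / a * Real.exp (κ * t - l) := by field_simp; norm_num
      _ ≤ K₁ / a * Real.exp (-(l : ℝ) / 2) := by
          have : κ * t ≤ κ * T := mul_le_mul_of_nonneg_left htT hκpos.le
          gcongr
          linarith
  -- times `t > c₁ l`: `‖{A(±t), B}‖ ≤ 2` and `k(t) ≤ e^{-πt/β}/(1 - e^{-2})`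
  have hlarge : ∀ t ∈ Set.Ioi T, ‖F t‖ ≤ 4 / (1 - Real.exp (-2)) * Real.exp (-(a * t)) := by
    intro t ht
    have ht' : T < t := ht
    have ht0 : 0 < t := hT.trans ht'
    have hk1 : K t ≤ Real.exp (-(a * t)) / (1 - Real.exp (-(2 * (a * T)))) :=
      matsubaraKernel_le_exp_div (mul_pos ha hT) (by nlinarith)
    have hk2 : Real.exp (-(a * t)) / (1 - Real.exp (-(2 * (a * T)))) ≤
        Real.exp (-(a * t)) / (1 - Real.exp (-2)) := by
      refine div_le_div_of_nonneg_left (Real.exp_pos _).le he2 ?_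
      have : Real.exp (-(2 * (a * T))) ≤ Real.exp (-2) := Real.exp_le_exp.2 (by nlinarith)
      linarith
    refine (hFnorm t ht0).trans ?_
    calc K t * (‖heisenbergEvolution H t A * B + B * heisenbergEvolution H t A‖ +
          ‖heisenbergEvolution H (-t) A * B + B * heisenbergEvolution H (-t) A‖)
        ≤ K t * (2 + 2) := mul_le_mul_of_nonneg_left (add_le_add (hanti_triv t) (hanti_triv (-t)))
            (matsubaraKernel_pos (mul_pos ha ht0)).le
      _ ≤ Real.exp (-(a * t)) / (1 - Real.exp (-2)) * (2 + 2) :=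
          mul_le_mul_of_nonneg_right (hk1.trans hk2) (by norm_num)
      _ = 4 / (1 - Real.exp (-2)) * Real.exp (-(a * t)) := by ring
  -- integrability of `F` and Hastings' split `∫₀^∞ = ∫₀^T + ∫_T^∞`
  have hFint : MeasureTheory.IntegrableOn F (Set.Ioi 0) := by
    have h := hInt'.const_mul ((Z : ℂ)⁻¹)
    refine MeasureTheory.IntegrableOn.congr_fun h (fun t _ => ?_) measurableSet_Ioi
    simp only [hF, hGg]
    ring
  have hI := norm_integral_Ioi_le_of_split ha hT hFint hsmall hlarge
  -- the two exponentials against `e^{-c₀ l/β}`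
  have hexp1 : Real.exp (-(l : ℝ) / 2) * T ≤ 1 / (2 * κ) * (4 / Real.exp 1) * Real.exp (-(c₀ * (l : ℝ) / β)) := by
    have hl' : (0 : ℝ) ≤ l := Nat.cast_nonneg l
    have h1 := mul_exp_neg_half_le (l : ℝ)
    have h2 : Real.exp (-(l : ℝ) / 4) ≤ Real.exp (-(c₀ * (l : ℝ) / β)) := by
      rw [Real.exp_le_exp]
      have h3 : c₀ * (l : ℝ) / β ≤ c₀ * (l : ℝ) / 1 :=
        div_le_div_of_nonneg_left (by positivity) one_pos hβ
      have h4 : c₀ * (l : ℝ) ≤ 1 / 4 * (l : ℝ) := mul_le_mul_of_nonneg_right hc₀_le_quarter hl'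
      linarith
    calc Real.exp (-(l : ℝ) / 2) * T = 1 / (2 * κ) * ((l : ℝ) * Real.exp (-(l : ℝ) / 2)) := by
          rw [hT_def]; ring
      _ ≤ 1 / (2 * κ) * (4 / Real.exp 1 * Real.exp (-(l : ℝ) / 4)) := by gcongr
      _ ≤ 1 / (2 * κ) * (4 / Real.exp 1 * Real.exp (-(c₀ * (l : ℝ) / β))) := by gcongr
      _ = _ := by ring
  have hexp2 : Real.exp (-(a * T)) ≤ Real.exp (-(c₀ * (l : ℝ) / β)) := by
    rw [Real.exp_le_exp, neg_le_neg_iff]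
    have : a * T = Real.pi / (2 * κ) * (l : ℝ) / β := by rw [ha_def, hT_def]; ring
    rw [this]
    exact div_le_div_of_nonneg_right (mul_le_mul_of_nonneg_right hc₀_le (Nat.cast_nonneg l)) hβpos.le
  have hnormI : ‖I / (β : ℂ)‖ = 1 / β := by
    rw [norm_div, Complex.norm_I, Complex.norm_real, Real.norm_of_nonneg hβpos.le]
  calc ‖gibbsState β H (A * B)‖ = ‖I / (β : ℂ)‖ * ‖∫ t in Set.Ioi (0 : ℝ), F t‖ := by
        rw [hGS, norm_mul]
    _ ≤ 1 / β * (K₁ / a * Real.exp (-(l : ℝ) / 2) * T +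
          4 / (1 - Real.exp (-2)) * (Real.exp (-(a * T)) / a)) := by
        rw [hnormI]
        exact mul_le_mul_of_nonneg_left hI (by positivity)
    _ = K₁ / Real.pi * (Real.exp (-(l : ℝ) / 2) * T) +
          4 / (Real.pi * (1 - Real.exp (-2))) * Real.exp (-(a * T)) := by
        have hβ0 : β ≠ 0 := hβpos.ne'
        have he20 : 1 - Real.exp (-2) ≠ 0 := he2.ne'
        rw [ha_def]
        field_simp
    _ ≤ K₁ / Real.pi * (1 / (2 * κ) * (4 / Real.exp 1) * Real.exp (-(c₀ * (l : ℝ) / β))) +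
          4 / (Real.pi * (1 - Real.exp (-2))) * Real.exp (-(c₀ * (l : ℝ) / β)) := by
        gcongr
    _ = C₁ * Real.exp (-(c₀ * (l : ℝ) / β)) := by rw [hC₁]; ring
    _ ≤ (Real.exp 1 + C₁) * Real.exp (-(c₀ * (l : ℝ) / β)) := by
        gcongr
        linarith [Real.exp_pos (1 : ℝ)]

/-- **Discharge of `hastings2004_oneBody_thermal_decay_hubbardTorus`** (M. B. Hastings, *Decay of
correlations in Fermi systems at nonzero temperature*, Phys. Rev. Lett. 93 (2004) 126402 =
arXiv:cond-mat/0406348, eq. (1) with `ξ ≤ max(ξ_C, vβ/π)` (paragraph after eq. (13)), Hubbard-torus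
instance): for every `U, μ` there are `C, c₀ > 0` with
`|⟨c†_{xσ} c_{yσ}⟩_{β,L,U,μ}| ≤ C exp(-c₀ dist(x,y)/β)` for all `β ≥ 1`, `L`, `x`, `y`, `σ`.
The constants are those of `norm_gibbsState_creation_annihilation_le`; the proof is Hastings' own
(integral representation (9) through anticommutators, eqs. (5)–(9); Lieb–Robinson bound for
anticommutators; the estimate (10)–(13)). [cite: HastingsPRL2004FermiDecay, eq. (1), eqs. (5)–(13)] -/
theorem hastings2004_oneBody_thermal_decay_hubbardTorus_holds :
    hastings2004_oneBody_thermal_decay_hubbardTorus := by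
  intro U μ
  refine ⟨_, _, ?_, fun β L _ hβ x y σ => norm_gibbsState_creation_annihilation_le U μ β L hβ x y σ⟩
  exact lt_min (by norm_num) (by positivity)

end Assembly

end Literature.MathematicalPhysics.QuantumLattice

end
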